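import Literature.Computability.Complexity.CircuitPlug
import Literature.Computability.Complexity.CircuitRestriction
import Literature.Computability.Complexity.AccFanIn
import Literature.Computability.Complexity.SymPlusProofs
import Literature.Computability.Complexity.Williams2014MachineB
import HarnessLib

/-!
# Williams' generator `A` (Lemma 3.1), part 2: the circuit VALUE as a DNF over guessed blocks

R. Williams, *Nonuniform ACC circuit lower bounds*, J. ACM 61 (2014), proof of Lemma 3.1
(p. 11): the generator checks its guessed `ACC` circuits `E` with ONE satisfiability call on a
constant-depth circuit VALUE built on top of copies of the guessed circuits ("VALUE(i, j) = 1 iff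
… the values claimed by `E` are inconsistent …; VALUE is unsatisfiable iff `E` is correct").
In the tree's machine `A` (`Williams2014ClauseBit.lean`) every check — a violated Cook–Levin
clause of the tableau of the clause-bit machine, a violated pin of a certificate cell to an input
bit, each guarded by the guessed output bit or its negation — is a CONJUNCTION OF LITERALS over
the outputs of the guessed blocks and the input bits, and VALUE is their disjunction. This file
builds that generic circuit in the straight-line calculus of `CircuitPlug.lean` and proves its
semantics and its syntactic class:

* `GateList.carries_batch`, `GateList.wf_batch`: appending a batch of gates each of which reads
  only wires of the base program (the shape of every layer below, and of the code-level printer of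
  part 3);
* `MachineA.dnfCircuit blocks terms : Circuit (Fin w)` for a list of blocks (circuits on the same
  `w` inputs) and a list of terms (lists of literals `(neg, fromInput, index)`, `MachineA.Lit`):
  the blocks side by side (`GateList.layerL`), the two constants, a negation of every block output
  and of every input, one `∧`-gate per term, one `∨`-gate; out-of-range indices read the constant
  `0` (`litVal`), so no side condition is needed anywhere;
* `eval_dnfCircuit`: `VALUE(u) = ⋁_{t ∈ terms} ⋀_{l ∈ t} litVal u l`; `acDepth_dnfCircuit_le`
  (`≤ max d 1 + 2` for blocks of depth `≤ d`: negations are free in `acDepth`), `size_dnfCircuit`,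
  `isOver_dnfCircuit` (`accBasis m`), `maxFanIn_dnfCircuit_le`, and the definitional shape
  `gates_dnfCircuit` / `output_dnfCircuit` used by the printer.

Everything is proved; no named fact is introduced (Vollmer 1999, §1.2: composition of circuits).

## References

* R. Williams, *Nonuniform ACC circuit lower bounds*, J. ACM 61 (2014) 2:1–2:32, Lemma 3.1
  (proof, p. 11: the circuit VALUE) [Williams2014].
* H. Vollmer, *Introduction to Circuit Complexity*, Springer 1999, §1.2 [Vollmer1999].
-/

namespace Literature.Computability.Complexity

namespace GateList

open Finset

variable {ι : Type*}

/-! ### Appending a batch of gates reading only earlier wires -/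

/-- **A batch of gates behind a program**: if gate `k` of the batch `gl` is `g` and reads wires
of `gs` carrying `F a` at depth `≤ d`, then in `gs ++ gl` the wire of that gate carries `g`
applied to the `F a`, at depth its weight plus `d` (the other gates of the batch are irrelevant: a
program is read left to right). [cite: Vollmer1999, §1.2] -/
theorem carries_batch (gs gl : List (Gate ι)) {k : ℕ} {g : Gate ι} (hk : gl[k]? = some g)
    {F : Fin g.arity → (ι → Bool) → Bool} {d : ℕ}
    (h : ∀ a, Carries gs (g.args a) (F a) d) :
    Carries (gs ++ gl) (Sum.inr (gs.length + k)) (fun x => g.op fun a => F a x)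
      (acWeight g.fn + d) := by
  obtain ⟨hlt, rfl⟩ := List.getElem?_eq_some_iff.1 hk
  have hsplit : gs ++ gl = (gs ++ gl.take k) ++ [gl[k]] ++ gl.drop (k + 1) := by
    conv_lhs => rw [← List.take_append_drop k gl, List.drop_eq_getElem_cons hlt]
    simp
  have hlen : (gs ++ gl.take k).length = gs.length + k := by
    simp [Nat.min_eq_left hlt.le]
  have h' : ∀ a, Carries (gs ++ gl.take k) ((gl[k]).args a) (F a) d := fun a => (h a).append _
  have hc := carries_snoc (gs ++ gl.take k) (gl[k]) (F := fun x => (gl[k]).op fun a => F a x)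
    (d := acWeight (gl[k]).fn + d)
    (fun x => congrArg (gl[k]).op (funext fun a => (h' a).eval x))
    (Nat.add_le_add_left (Finset.sup_le fun a _ => (h' a).depth) _)
  have := hc.append (gl.drop (k + 1))
  rw [hlen] at this
  rw [hsplit]
  exact this

/-- A batch of gates reading only wires of the base program keeps it well formed. [folklore] -/
theorem wf_batch {gs gl : List (Gate ι)} (hwf : WF gs) (hgl : ∀ g ∈ gl, GateOK gs.length g) :
    WF (gs ++ gl) :=
  hwf.append fun _ g hj a m hm =>
    (hgl g (List.mem_of_getElem? hj) a m hm).trans_le (Nat.le_add_right _ _)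

/-- Gates of a batch extension. [folklore] -/
theorem fn_mem_batch {B : Set GateFn} {gs gl : List (Gate ι)} (h : ∀ g ∈ gs, g.fn ∈ B)
    (h' : ∀ g ∈ gl, g.fn ∈ B) : ∀ g ∈ gs ++ gl, g.fn ∈ B := by
  intro g hg
  rcases List.mem_append.1 hg with hg | hg
  · exact h g hg
  · exact h' g hg

/-- Arities of a batch extension. [folklore] -/
theorem arity_le_batch {K : ℕ} {gs gl : List (Gate ι)} (h : ∀ g ∈ gs, g.arity ≤ K)
    (h' : ∀ g ∈ gl, g.arity ≤ K) : ∀ g ∈ gs ++ gl, g.arity ≤ K := by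
  intro g hg
  rcases List.mem_append.1 hg with hg | hg
  · exact h g hg
  · exact h' g hg

/-- The value of an unbounded `∧`-gate. [folklore] -/
@[simp] theorem bigGate_op_true {k : ℕ} (args : Fin k → ι ⊕ ℕ) (v : Fin k → Bool) :
    (bigGate true k args).op v = decide (∀ a, v a = true) := rfl

/-- The value of an unbounded `∨`-gate. [folklore] -/
@[simp] theorem bigGate_op_false {k : ℕ} (args : Fin k → ι ⊕ ℕ) (v : Fin k → Bool) :
    (bigGate false k args).op v = decide (∃ a, v a = true) := rfl

/-- The gate function of an unbounded gate is in `acBasis`. [folklore] -/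
theorem bigGate_fn_mem_acBasis (b : Bool) (k : ℕ) (args : Fin k → ι ⊕ ℕ) :
    (bigGate b k args).fn ∈ acBasis := by
  rw [bigGate_fn]
  cases b
  · exact or_mem_acBasis k
  · exact and_mem_acBasis k

/-- The weight of an unbounded gate is `1`. [folklore] -/
@[simp] theorem acWeight_bigGate_fn (b : Bool) (k : ℕ) (args : Fin k → ι ⊕ ℕ) :
    acWeight (bigGate b k args).fn = 1 := by
  rw [bigGate_fn]
  cases b <;> simp

/-- Arities in a layer are arities of its circuits' gates. [folklore] -/
theorem arity_le_layerL {K : ℕ} {Cs : List (Circuit ι)} (h : ∀ C ∈ Cs, C.maxFanIn ≤ K) :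
    ∀ g ∈ (layerL Cs).1, g.arity ≤ K := by
  refine MachineB.forall_arity_parBlocks _ fun b hb g hg => ?_
  obtain ⟨C, hC, rfl⟩ := List.mem_map.1 hb
  exact (BT.arity_le_maxFanIn C hg).trans (h C hC)

end GateList

/-! ### The DNF-of-blocks circuit -/

namespace MachineA

open GateList Finset

variable {w : ℕ}

/-- A **literal** of VALUE: `(neg, fromInput, k)` reads input bit `k` (if `fromInput`) or the
output of guessed block `k`, negated if `neg`. [cite: Williams2014, Lemma 3.1 (proof)] -/
abbrev Lit : Type := Bool × Bool × ℕ

/-- The value of block `k` (the constant `0` out of range). [folklore] -/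
def blockVal (blocks : List (Circuit (Fin w))) (u : Fin w → Bool) (k : ℕ) : Bool :=
  if h : k < blocks.length then (blocks[k]).eval u else false

/-- The value of input `j` (the constant `0` out of range). [folklore] -/
def inputVal (w : ℕ) (u : Fin w → Bool) (j : ℕ) : Bool :=
  if h : j < w then u ⟨j, h⟩ else false

/-- **The value of a literal.** [cite: Williams2014, Lemma 3.1 (proof)] -/
def litVal (blocks : List (Circuit (Fin w))) (u : Fin w → Bool) (l : Lit) : Bool :=
  xor (if l.2.1 then inputVal w u l.2.2 else blockVal blocks u l.2.2) l.1

/-- **The value of VALUE**: some term has all its literals true. [cite: Williams2014, Lemma 3.1 (proof)] -/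
def dnfVal (blocks : List (Circuit (Fin w))) (terms : List (List Lit)) (u : Fin w → Bool) : Bool :=
  terms.any fun t => t.all (litVal blocks u)

section Build

variable (blocks : List (Circuit (Fin w))) (terms : List (List Lit))

/-- Number of gates of the block layer. [folklore] -/
def L1 : ℕ := (layerL blocks).1.length

/-- Stage 1: the blocks side by side, then the constants `0` (`∨₀`) and `1` (`∧₀`). [folklore] -/
def base : List (Gate (Fin w)) :=
  (layerL blocks).1 ++ [bigGate false 0 Fin.elim0, bigGate true 0 Fin.elim0]

/-- The constant-`0` wire. [folklore] -/
def fW : Fin w ⊕ ℕ := Sum.inr (L1 blocks)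

/-- The constant-`1` wire. [folklore] -/
def tW : Fin w ⊕ ℕ := Sum.inr (L1 blocks + 1)

/-- The output wire of block `k` (the constant `0` out of range). [folklore] -/
def outW (k : ℕ) : Fin w ⊕ ℕ :=
  if h : k < blocks.length then ((layerL blocks).2)[k]'(by rw [length_layerL_snd]; exact h) else fW blocks

/-- The wire of input `j` (the constant `0` out of range). [folklore] -/
def inW (j : ℕ) : Fin w ⊕ ℕ := if h : j < w then Sum.inl ⟨j, h⟩ else fW blocks

/-- Stage 2: a negation of every block output and of every input. [folklore] -/
def withNots : List (Gate (Fin w)) :=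
  base blocks ++ (((List.range blocks.length).map fun k => notGate (outW blocks k)) ++
    ((List.range w).map fun j => notGate (inW blocks j)))

/-- The negated output wire of block `k` (the constant `1` out of range). [folklore] -/
def notOutW (k : ℕ) : Fin w ⊕ ℕ :=
  if k < blocks.length then Sum.inr (L1 blocks + 2 + k) else tW blocks

/-- The negated wire of input `j` (the constant `1` out of range). [folklore] -/
def notInW (j : ℕ) : Fin w ⊕ ℕ :=
  if j < w then Sum.inr (L1 blocks + 2 + blocks.length + j) else tW blocks

/-- The wire of a literal. [folklore] -/
def litW (l : Lit) : Fin w ⊕ ℕ :=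
  if l.2.1 then (if l.1 then notInW blocks l.2.2 else inW blocks l.2.2)
  else (if l.1 then notOutW blocks l.2.2 else outW blocks l.2.2)

/-- The `∧`-gate of a term. [folklore] -/
def termGate (t : List Lit) : Gate (Fin w) := bigGate true t.length fun q => litW blocks (t.get q)

/-- Number of gates before the term layer. [folklore] -/
def L2 : ℕ := L1 blocks + 2 + blocks.length + w

/-- Stage 3: one `∧`-gate per term. [folklore] -/
def withTerms : List (Gate (Fin w)) := withNots blocks ++ terms.map (termGate blocks)

/-- The final `∨`-gate over the term wires. [folklore] -/
def finalGate : Gate (Fin w) :=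
  bigGate false terms.length fun r => Sum.inr (L2 blocks + r)

/-- All gates of VALUE. [folklore] -/
def dnfGates : List (Gate (Fin w)) := withTerms blocks terms ++ [finalGate blocks terms]

/-! #### Lengths -/

/-- `|base| = L1 + 2`. [folklore] -/
theorem length_base : (base blocks).length = L1 blocks + 2 := by
  simp [base, L1]

/-- `|withNots| = L2`. [folklore] -/
theorem length_withNots : (withNots blocks).length = L2 blocks := by
  simp only [withNots, List.length_append, length_base, List.length_map, List.length_range, L2]
  ring

/-- `|withTerms| = L2 + |terms|`. [folklore] -/
theorem length_withTerms : (withTerms blocks terms).length = L2 blocks + terms.length := by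
  simp [withTerms, length_withNots]

/-- `|dnfGates| = L2 + |terms| + 1`. [folklore] -/
theorem length_dnfGates : (dnfGates blocks terms).length = L2 blocks + terms.length + 1 := by
  simp [dnfGates, length_withTerms]

/-- `L1` is the total size of the blocks. [folklore] -/
theorem L1_eq : L1 blocks = (blocks.map Circuit.size).sum := length_layerL_fst blocks

/-! #### Well-formedness -/

/-- The constant wires and block outputs exist in `base`. [folklore] -/
theorem outOK_outW (k : ℕ) : OutOK (base blocks).length (outW blocks k) := by
  intro m hm
  rw [length_base]
  unfold outW at hm
  split_ifs at hm with h
  · have hwf := (wf_layerL blocks)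
    -- the `k`-th output wire of the layer is a wire of the layer
    have hc := carries_layerL blocks k h le_rfl
    have := hc.outOK m hm
    simp only [L1]
    omega
  · simp only [fW, Sum.inr.injEq] at hm
    omega

/-- Input wires exist. [folklore] -/
theorem outOK_inW (k : ℕ) : OutOK (base blocks).length (inW blocks k) := by
  intro m hm
  unfold inW at hm
  split_ifs at hm with h
  simp only [fW, Sum.inr.injEq] at hm
  rw [length_base]; omega

/-- `base` is well formed. [folklore] -/
theorem wf_base : WF (base blocks) := by
  unfold base
  rw [show (layerL blocks).1 ++ [bigGate false 0 Fin.elim0, bigGate true 0 Fin.elim0] =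
    ((layerL blocks).1 ++ [bigGate false 0 Fin.elim0]) ++ [bigGate true 0 Fin.elim0] by simp]
  exact ((wf_layerL blocks).append_singleton fun a => a.elim0).append_singleton fun a => a.elim0

/-- `withNots` is well formed. [folklore] -/
theorem wf_withNots : WF (withNots blocks) := by
  refine wf_batch (wf_base blocks) fun g hg => ?_
  simp only [List.mem_append, List.mem_map, List.mem_range] at hg
  rcases hg with ⟨k, -, rfl⟩ | ⟨j, -, rfl⟩
  · exact fun _ m hm => outOK_outW blocks k m hm
  · exact fun _ m hm => outOK_inW blocks j m hm

/-- Negated output wires exist in `withNots`. [folklore] -/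
theorem outOK_notOutW (k : ℕ) : OutOK (withNots blocks).length (notOutW blocks k) := by
  intro m hm
  rw [length_withNots, L2]
  unfold notOutW tW at hm
  split_ifs at hm with h <;> simp only [Sum.inr.injEq] at hm <;> omega

/-- Negated input wires exist in `withNots`. [folklore] -/
theorem outOK_notInW (j : ℕ) : OutOK (withNots blocks).length (notInW blocks j) := by
  intro m hm
  rw [length_withNots, L2]
  unfold notInW tW at hm
  split_ifs at hm with h <;> simp only [Sum.inr.injEq] at hm <;> omega

/-- Literal wires exist in `withNots`. [folklore] -/
theorem outOK_litW (l : Lit) : OutOK (withNots blocks).length (litW blocks l) := by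
  have hlen : (base blocks).length ≤ (withNots blocks).length := by
    rw [length_withNots, length_base, L2]; omega
  unfold litW
  split_ifs
  · exact outOK_notInW blocks _
  · exact fun m hm => (outOK_inW blocks _ m hm).trans_le hlen
  · exact outOK_notOutW blocks _
  · exact fun m hm => (outOK_outW blocks _ m hm).trans_le hlen

/-- `withTerms` is well formed. [folklore] -/
theorem wf_withTerms : WF (withTerms blocks terms) := by
  refine wf_batch (wf_withNots blocks) fun g hg => ?_
  obtain ⟨t, -, rfl⟩ := List.mem_map.1 hg
  exact fun q m hm => outOK_litW blocks _ m hm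

/-- All gates of VALUE are well formed. [folklore] -/
theorem wf_dnfGates : WF (dnfGates blocks terms) := by
  refine (wf_withTerms blocks terms).append_singleton fun r m hm => ?_
  simp only [finalGate, bigGate, Sum.inr.injEq] at hm
  rw [length_withTerms]
  have := r.isLt
  omega

/-- **The circuit VALUE** of the blocks and terms: output the final `∨`-gate.
[cite: Williams2014, Lemma 3.1 (proof, p. 11)] -/
def dnfCircuit : Circuit (Fin w) :=
  toCircuit (dnfGates blocks terms) (Sum.inr (withTerms blocks terms).length) (wf_dnfGates blocks terms)
    (fun m hm => by
      simp only [Sum.inr.injEq] at hm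
      rw [← hm, dnfGates, List.length_append, List.length_singleton]
      exact Nat.lt_succ_self _)

/-- The gates of VALUE (definitional). [folklore] -/
theorem gates_dnfCircuit : (dnfCircuit blocks terms).gates = dnfGates blocks terms := rfl

/-- The output wire of VALUE (definitional). [folklore] -/
theorem output_dnfCircuit :
    (dnfCircuit blocks terms).output = Sum.inr (withTerms blocks terms).length := rfl

/-- **The size of VALUE**: the blocks, two constants, one negation per block and per input, one
gate per term, one output gate. [folklore] -/
theorem size_dnfCircuit : (dnfCircuit blocks terms).size =
    (blocks.map Circuit.size).sum + 2 + blocks.length + w + terms.length + 1 := by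
  rw [Circuit.size, gates_dnfCircuit, length_dnfGates, L2, L1_eq]

/-! #### Basis and fan-in -/

/-- VALUE is over `accBasis m` when the blocks are. [folklore] -/
theorem isOver_dnfCircuit {m : ℕ} (hB : ∀ C ∈ blocks, C.IsOver (accBasis m)) :
    (dnfCircuit blocks terms).IsOver (accBasis m) := by
  change ∀ g ∈ dnfGates blocks terms, g.fn ∈ accBasis m
  have hsub := acBasis_subset_accBasis m
  refine fn_mem_snoc (fn_mem_batch (fn_mem_batch (fn_mem_batch (fn_mem_layerL hB) ?_) ?_) ?_) ?_
  · intro g hg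
    simp only [List.mem_cons, List.mem_nil_iff, or_false] at hg
    rcases hg with rfl | rfl <;> exact hsub (bigGate_fn_mem_acBasis _ _ _)
  · intro g hg
    simp only [List.mem_append, List.mem_map, List.mem_range] at hg
    rcases hg with ⟨k, -, rfl⟩ | ⟨j, -, rfl⟩ <;> exact hsub (by rw [notGate_fn]; exact mem_acBasis_not)
  · intro g hg
    obtain ⟨t, -, rfl⟩ := List.mem_map.1 hg
    exact hsub (bigGate_fn_mem_acBasis _ _ _)
  · exact hsub (bigGate_fn_mem_acBasis _ _ _)

/-- **The fan-in of VALUE** is bounded by any common bound `K ≥ 1` of the fan-ins of the blocks,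
the lengths of the terms and their number. [folklore] -/
theorem maxFanIn_dnfCircuit_le {K : ℕ} (hK : 1 ≤ K) (hB : ∀ C ∈ blocks, C.maxFanIn ≤ K)
    (ht : ∀ t ∈ terms, t.length ≤ K) (hn : terms.length ≤ K) :
    (dnfCircuit blocks terms).maxFanIn ≤ K := by
  refine Circuit.maxFanIn_le_of_forall _ ?_
  rw [gates_dnfCircuit]
  refine MachineB.forall_arity_snoc (arity_le_batch (arity_le_batch (arity_le_batch
    (arity_le_layerL hB) ?_) ?_) ?_) ?_
  · intro g hg
    simp only [List.mem_cons, List.mem_nil_iff, or_false] at hg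
    rcases hg with rfl | rfl <;> exact Nat.zero_le _
  · intro g hg
    simp only [List.mem_append, List.mem_map, List.mem_range] at hg
    rcases hg with ⟨k, -, rfl⟩ | ⟨j, -, rfl⟩ <;> exact hK
  · intro g hg
    obtain ⟨t, ht', rfl⟩ := List.mem_map.1 hg
    exact ht t ht'
  · exact hn

/-! #### Semantics and depth -/

variable {blocks}

/-- The constant-`0` wire. [folklore] -/
theorem carries_fW : Carries (base blocks) (fW blocks) (fun _ => false) 1 := by
  have h := carries_snoc (layerL blocks).1 (bigGate false 0 (Fin.elim0 : Fin 0 → Fin w ⊕ ℕ))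
    (F := fun _ => false) (d := 1) (fun x => by simp)
    (by rw [acWeight_bigGate_fn]; exact Nat.add_le_add_left (Finset.sup_le (a := 0) fun a _ => Fin.elim0 a) 1)
  have := h.append [bigGate true 0 Fin.elim0]
  rw [List.append_assoc] at this
  exact this

/-- The constant-`1` wire. [folklore] -/
theorem carries_tW : Carries (base blocks) (tW blocks) (fun _ => true) 1 := by
  have h := carries_snoc ((layerL blocks).1 ++ [bigGate false 0 Fin.elim0])
    (bigGate true 0 (Fin.elim0 : Fin 0 → Fin w ⊕ ℕ))
    (F := fun _ => true) (d := 1) (fun x => by simp)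
    (by rw [acWeight_bigGate_fn]; exact Nat.add_le_add_left (Finset.sup_le (a := 0) fun a _ => Fin.elim0 a) 1)
  rw [List.append_assoc] at h
  simpa [base, tW, L1] using h

/-- **Block outputs in `base`**: the wire `outW k` carries `blockVal k` at depth `max d 1` when
the blocks have depth `≤ d`. [cite: Vollmer1999, §1.2] -/
theorem carries_outW {d : ℕ} (hd : ∀ C ∈ blocks, C.acDepth ≤ d) (k : ℕ) :
    Carries (base blocks) (outW blocks k) (fun u => blockVal blocks u k) (max d 1) := by
  unfold outW blockVal
  split_ifs with h
  · have hc := carries_layerL blocks k h (hd _ (List.getElem_mem h))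
    exact (hc.append _).mono (le_max_left _ _)
  · exact carries_fW.mono (le_max_right _ _)

/-- Input wires in `base`. [folklore] -/
theorem carries_inW (d : ℕ) (j : ℕ) :
    Carries (base blocks) (inW blocks j) (fun u => inputVal w u j) d.succ := by
  unfold inW inputVal
  split_ifs with h
  · exact (carries_input _ _).mono (Nat.zero_le _)
  · exact carries_fW.mono (Nat.succ_le_succ (Nat.zero_le _))

/-- **Negated block outputs in `withNots`.** [cite: Vollmer1999, §1.2] -/
theorem carries_notOutW {d : ℕ} (hd : ∀ C ∈ blocks, C.acDepth ≤ d) (k : ℕ) :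
    Carries (withNots blocks) (notOutW blocks k) (fun u => !blockVal blocks u k) (max d 1) := by
  unfold notOutW
  split_ifs with h
  · have hk : ((List.range blocks.length).map fun k => notGate (outW blocks k))[k]? =
        some (notGate (outW blocks k)) := by simp [h]
    have hc := carries_batch (base blocks) _ hk (F := fun _ u => blockVal blocks u k) (d := max d 1)
      fun _ => carries_outW hd k
    simp only [notGate_fn, acWeight, if_true, zero_add, length_base] at hc
    have hc' := hc.append ((List.range w).map fun j => notGate (inW blocks j))
    rw [List.append_assoc] at hc'
    exact hc'
  · have : (fun u : Fin w → Bool => !blockVal blocks u k) = fun _ => true := by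
      funext u; simp [blockVal, h]
    rw [this]
    exact (carries_tW.append _).mono (le_max_right _ _)

/-- **Negated inputs in `withNots`.** [cite: Vollmer1999, §1.2] -/
theorem carries_notInW (d : ℕ) (j : ℕ) :
    Carries (withNots blocks) (notInW blocks j) (fun u => !inputVal w u j) d.succ := by
  unfold notInW
  split_ifs with h
  · have hj : ((List.range w).map fun j => notGate (inW blocks j))[j]? = some (notGate (inW blocks j)) := by
      simp [h]
    have hc := carries_batch (base blocks ++ (List.range blocks.length).map fun k => notGate (outW blocks k))
      _ hj (F := fun _ u => inputVal w u j) (d := d.succ) fun _ => (carries_inW d j).append _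
    simp only [notGate_fn, acWeight, if_true, zero_add, List.length_append, length_base,
      List.length_map, List.length_range] at hc
    rw [List.append_assoc] at hc
    exact hc
  · have : (fun u : Fin w → Bool => !inputVal w u j) = fun _ => true := by
      funext u; simp [inputVal, h]
    rw [this]
    exact (carries_tW.append _).mono (Nat.succ_le_succ (Nat.zero_le _))

/-- **Literal wires carry literal values** at depth `max d 1`. [cite: Vollmer1999, §1.2] -/
theorem carries_litW {d : ℕ} (hd : ∀ C ∈ blocks, C.acDepth ≤ d) (l : Lit) :
    Carries (withNots blocks) (litW blocks l) (fun u => litVal blocks u l) (max d 1) := by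
  obtain ⟨ng, isIn, k⟩ := l
  cases isIn <;> cases ng <;>
    simp only [litW, litVal, Bool.xor_false, Bool.xor_true, if_true, Bool.false_eq_true, if_false]
  · exact (carries_outW hd k).append _
  · exact carries_notOutW hd k
  · exact ((carries_inW 0 k).append _).mono (le_max_right _ _)
  · exact (carries_notInW 0 k).mono (le_max_right _ _)

/-- **Term wires carry conjunctions** at depth `max d 1 + 1`. [cite: Vollmer1999, §1.2] -/
theorem carries_term {d : ℕ} (hd : ∀ C ∈ blocks, C.acDepth ≤ d) {r : ℕ} (hr : r < terms.length) :
    Carries (withTerms blocks terms) (Sum.inr (L2 blocks + r))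
      (fun u => (terms[r]).all (litVal blocks u)) (max d 1 + 1) := by
  have hr' : (terms.map (termGate blocks))[r]? = some (termGate blocks terms[r]) := by simp [hr]
  have hc := carries_batch (withNots blocks) _ hr'
    (F := fun q u => litVal blocks u ((terms[r]).get q)) (d := max d 1) fun a => carries_litW hd _
  simp only [termGate, bigGate_op_true, acWeight_bigGate_fn, length_withNots] at hc
  refine (hc.congr fun u => ?_).mono (by omega)
  rw [Bool.eq_iff_iff]
  simp only [decide_eq_true_eq, List.all_eq_true]
  constructor
  · intro h l hl
    obtain ⟨q, rfl⟩ := List.mem_iff_get.1 hl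
    exact h q
  · intro h a
    exact h _ (List.get_mem _ _)

/-- **The output wire carries the DNF** at depth `max d 1 + 2`. [cite: Vollmer1999, §1.2] -/
theorem carries_output {d : ℕ} (hd : ∀ C ∈ blocks, C.acDepth ≤ d) :
    Carries (dnfGates blocks terms) (Sum.inr (withTerms blocks terms).length)
      (dnfVal blocks terms) (max d 1 + 2) := by
  refine carries_snoc (withTerms blocks terms) (finalGate blocks terms)
    (F := dnfVal blocks terms) (d := max d 1 + 2) (fun u => ?_) ?_
  · change decide (∃ a : Fin terms.length,
        wireOf u (vals (withTerms blocks terms) u) (Sum.inr (L2 blocks + a)) = true) = dnfVal blocks terms u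
    rw [dnfVal, Bool.eq_iff_iff]
    simp only [decide_eq_true_eq, List.any_eq_true]
    constructor
    · rintro ⟨a, ha⟩
      refine ⟨terms[(a : ℕ)]'a.isLt, List.getElem_mem _, ?_⟩
      rw [← (carries_term terms hd a.isLt).eval u]
      exact ha
    · rintro ⟨t, ht, hall⟩
      obtain ⟨a, ha, rfl⟩ := List.getElem_of_mem ht
      exact ⟨⟨a, ha⟩, by rw [(carries_term terms hd ha).eval u]; exact hall⟩
  · have hsup : (Finset.univ.sup fun a : Fin (finalGate blocks terms).arity =>
        wireDepthOf (wdepths acWeight (withTerms blocks terms)) ((finalGate blocks terms).args a)) ≤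
        max d 1 + 1 :=
      Finset.sup_le fun a _ => (carries_term terms hd a.isLt).depth
    have hw : acWeight (finalGate blocks terms).fn = 1 := acWeight_bigGate_fn _ _ _
    omega

/-- A depth bound for the blocks (the sum of their depths). [folklore] -/
theorem acDepth_le_sum {C : Circuit (Fin w)} (hC : C ∈ blocks) :
    C.acDepth ≤ (blocks.map Circuit.acDepth).sum :=
  List.le_sum_of_mem (List.mem_map_of_mem hC)

/-- **The semantics of VALUE**: `VALUE(u) = 1` iff some term has all its literals true.
[cite: Williams2014, Lemma 3.1 (proof, p. 11)] -/
theorem eval_dnfCircuit (u : Fin w → Bool) :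
    (dnfCircuit blocks terms).eval u = dnfVal blocks terms u :=
  eval_toCircuit _ (carries_output terms fun _ hC => acDepth_le_sum hC) u

/-- **The depth of VALUE**: two more than the blocks (negations are free). [cite: Vollmer1999, §1.2] -/
theorem acDepth_dnfCircuit_le {d : ℕ} (hd : ∀ C ∈ blocks, C.acDepth ≤ d) :
    (dnfCircuit blocks terms).acDepth ≤ max d 1 + 2 :=
  acDepth_toCircuit_le _ (carries_output terms hd)

/-- VALUE is satisfiable iff some input makes some term true. [folklore] -/
theorem satisfiable_dnfCircuit_iff :
    (dnfCircuit blocks terms).Satisfiable ↔ ∃ u, dnfVal blocks terms u = true := by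
  simp only [Circuit.Satisfiable, eval_dnfCircuit]

end Build

end MachineA

end Literature.Computability.Complexity
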